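import Summits.ResolutionOfSingularities.ResolutionOfSingularities.Theses.SyzygyFlattening
import HarnessLib

/-!
# `SyzygyFlattening.Globalisation` (crux stmt-ResolutionOfSingularities-17061): load-bearing analysis
# of its ANTECEDENT — `A.FG` cannot be dropped (negative-side support; this file does NOT refute
# the crux, which is implied by the summit)

The crux is `∀ p prime, DZT p → ResolutionInChar p`, where `DZT p` ("dimension-zero valuative
termination") says: for every field `k` of characteristic `p`, every field `K ⊇ k`, every valuation
ring `O ⊇ k` of `K` with residue field algebraic over `k`, and every FINITELY GENERATED `k`-subalgebra
`A ⊆ O` with `Frac A = K`, the syzygy-flattening tower `T₀ = loc A`, `T_(m+1) = loc (nrm (chart T_m))`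
reaches a regular local ring.

Recorded here, sorry-free:

* (Context, kept in the crux workfile `Cruxes/Globalisation/Disproof.lean`, not restated here:) the
  summit implies the crux (`fun h p hp _ => h p hp`), so any refutation of the crux is a prime `p`
  with the antecedent true and resolution in characteristic `p` false — the crux is irrefutable short
  of that, and its only attackable content is its antecedent.
* `syzLoc_fix`, `syzChart_fix`, `syzNrm_fix` — the MECHANISM: every adjoined chart generator
  `det g / det x` is in `O` by the minimality clause, and `loc`, `nrm` do not leave `O` either, so on
  `A := O` itself (as a `k`-subalgebra) every operator of the tower fixes `A`: the tower is CONSTANT.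
* `syzygyTower_termination_false_without_FG` — hence the antecedent with the binder `A.FG` deleted
  (and NOTHING else changed: the `let`-telescope below is the route file's, byte for byte) is FALSE in
  every prime characteristic: take `k = 𝔽_p`, `K = HahnSeries ℚ 𝔽_p` (Hahn series with rational
  exponents), `O = {orderTop ≥ 0}` (a non-discrete rank-one valuation ring with residue field `𝔽_p`,
  so dimension zero), `A = O`; the constant tower `O` is not Noetherian (the principal ideals
  `(t^{1/(n+1)})` strictly increase), so it is never a regular local ring.
* Consequently the `FG`-free weakening of the crux holds VACUOUSLY (one line from the theorem; kept
  in the crux workfile `Cruxes/Globalisation/Disproof.lean`): finite generation of the affine model is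
  exactly what keeps the crux from being trivial.

No definition is introduced (the refuted proposition is stated inline).

Informal reading for the prover: the hypothesis `DZT p` can only ever be USED on finitely generated
models; nothing is lost, but any restatement of the crux must keep `A.FG` (or Noetherianity of `A`).
-/

noncomputable section

-- single-problem summit: the doubled namespace component is forced by the tree layout
set_option linter.dupNamespace false

namespace Summit.ResolutionOfSingularities.ResolutionOfSingularities.Theorems.Globalisation.Negative

/-! ## The mechanism: on `A = O` every operator of the tower is the identity -/

section FixedPoint

variable {k K : Type} [Field k] [Field K] [Algebra k K] (O : ValuationSubring K) (A : Subalgebra k K)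
  (hAO : ∀ x : K, x ∈ A ↔ x ∈ O)
include hAO

/-- `loc` (the route's `let loc`, verbatim) fixes the valuation ring itself. [folklore] -/
theorem syzLoc_fix :
    Algebra.adjoin k {y : K | ∃ a ∈ A, ∃ s ∈ A, s⁻¹ ∈ O ∧ y = a * s⁻¹} = A := by
  refine le_antisymm (Algebra.adjoin_le ?_) fun x hx => Algebra.subset_adjoin ?_
  · rintro y ⟨a, ha, s, -, hsO, rfl⟩
    exact A.mul_mem ha ((hAO _).2 hsO)
  · exact ⟨x, hx, 1, A.one_mem, by rw [inv_one]; exact O.one_mem, by rw [inv_one, mul_one]⟩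

/-- `chart` (the route's `let chart`, verbatim, for an arbitrary index `n` and an arbitrary ideal `J`
in place of `J B`) fixes the valuation ring itself: every adjoined ratio `det g / det x` lies in `O`
by the minimality clause (take `g' := g`). [folklore] -/
theorem syzChart_fix (n : ℕ) (J : Ideal ↥A) :
    Algebra.adjoin k ((A : Set K) ∪ {y : K | ∃ (b : ℕ → ℕ) (d : (i : ℕ) → ((Fin (b (i + 1)) → ↥A) →ₗ[↥A] (Fin (b i) → ↥A))) (ε : (Fin (b 0) → ↥A) →ₗ[↥A] (↥A ⧸ J)) (r : ℕ) (ι : ↥(LinearMap.range (d (n - 1))) →ₗ[↥A] (Fin r → ↥A)), Function.Surjective ε ∧ Function.Exact (d 0) ε ∧ (∀ i : ℕ, Function.Exact (d (i + 1)) (d i)) ∧ Function.Injective ι ∧ (∀ z : Fin r → ↥A, ∃ a : ↥A, a ≠ 0 ∧ a • z ∈ LinearMap.range ι) ∧ ∃ g x : Fin r → ↥(LinearMap.range (d (n - 1))), Matrix.det (Matrix.of fun i j => ((ι (x i) j : ↥A) : K)) ≠ 0 ∧ (∀ g' : Fin r → ↥(LinearMap.range (d (n - 1))), Matrix.det (Matrix.of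 fun i j => ((ι (g' i) j : ↥A) : K)) * (Matrix.det (Matrix.of fun i j => ((ι (x i) j : ↥A) : K)))⁻¹ ∈ O) ∧ y = Matrix.det (Matrix.of fun i j => ((ι (g i) j : ↥A) : K)) * (Matrix.det (Matrix.of fun i j => ((ι (x i) j : ↥A) : K)))⁻¹}) = A := by
  refine le_antisymm (Algebra.adjoin_le ?_) fun x hx => Algebra.subset_adjoin (Set.mem_union_left _ hx)
  rintro y (hy | hy)
  · exact hy
  · obtain ⟨b, d, ε, r, ι, -, -, -, -, -, g, x, -, hx, rfl⟩ := hy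
    exact (hAO _).2 (hx g)

/-- `O.valuation` has `A` as ring of integers when `A` and `O` have the same elements. [folklore] -/
theorem integers_of_forall_mem_iff : O.valuation.Integers ↥A where
  hom_inj := Subtype.val_injective
  map_le_one x := (O.valuation_le_one_iff _).2 ((hAO _).1 x.2)
  exists_of_le_one r hr := ⟨⟨r, (hAO r).2 ((O.valuation_le_one_iff r).1 hr)⟩, rfl⟩

/-- `nrm` (the route's `let nrm`, verbatim) fixes the valuation ring itself (valuation rings are
integrally closed). [folklore] -/
theorem syzNrm_fix : Algebra.adjoin k {y : K | IsIntegral ↥A y} = A := by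
  refine le_antisymm (Algebra.adjoin_le ?_) fun x hx => Algebra.subset_adjoin ?_
  · intro y hy
    have h := (integers_of_forall_mem_iff O A hAO).mem_of_integral hy
    rw [ValuationSubring.integer_valuation] at h
    exact (hAO y).2 h
  · exact (isIntegral_algebraMap (R := ↥A) (A := K) (x := ⟨x, hx⟩))

end FixedPoint

/-- A `Nat.rec` tower whose base equals `a` and whose step fixes `a` is constantly `a`. [folklore] -/
theorem natRec_const {α : Type} {a z : α} {s : ℕ → α → α} (m : ℕ) (hz : z = a)
    (hs : ∀ m, s m a = a) : @Nat.rec (fun _ => α) z s m = a := by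
  induction m with
  | zero => exact hz
  | succ m ih => exact (congrArg (s m) ih).trans (hs m)

/-! ## The witness: Hahn series with rational exponents -/

section Hahn

variable (k : Type) [Field k]

/-- The natural (non-discrete, rank-one) valuation ring `{f | 0 ≤ orderTop f}` of the Hahn-series
field `k((t^ℚ))`. [folklore] -/
theorem exists_valuationSubring_hahnSeries :
    ∃ O : ValuationSubring (HahnSeries ℚ k), ∀ x, x ∈ O ↔ 0 ≤ x.orderTop := by
  refine ⟨⟨{ carrier := {x | 0 ≤ x.orderTop}
             mul_mem' := ?_, one_mem' := ?_, add_mem' := ?_, zero_mem' := ?_, neg_mem' := ?_ }, ?_⟩,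
    fun x => Iff.rfl⟩
  · intro a b ha hb
    refine le_trans ?_ HahnSeries.orderTop_add_le_mul
    exact add_nonneg ha hb
  · show (0 : WithTop ℚ) ≤ (1 : HahnSeries ℚ k).orderTop
    rw [HahnSeries.orderTop_one]
  · intro a b ha hb
    refine le_trans ?_ HahnSeries.min_orderTop_le_orderTop_add
    exact le_min ha hb
  · show (0 : WithTop ℚ) ≤ (0 : HahnSeries ℚ k).orderTop
    rw [HahnSeries.orderTop_zero]
    exact le_top
  · intro x hx
    show (0 : WithTop ℚ) ≤ (-x).orderTop
    rw [HahnSeries.orderTop_neg]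
    exact hx
  · intro x
    by_cases hx : x = 0
    · left
      show (0 : WithTop ℚ) ≤ x.orderTop
      rw [hx, HahnSeries.orderTop_zero]
      exact le_top
    · have hx' : x⁻¹ ≠ 0 := inv_ne_zero hx
      have hsum : x.order + x⁻¹.order = 0 := by
        rw [← HahnSeries.order_mul hx hx', mul_inv_cancel₀ hx, HahnSeries.order_one]
      rcases le_total 0 x.order with h | h
      · left
        show (0 : WithTop ℚ) ≤ x.orderTop
        rw [← HahnSeries.order_eq_orderTop_of_ne_zero hx]
        exact_mod_cast h
      · right
        show (0 : WithTop ℚ) ≤ x⁻¹.orderTop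
        rw [← HahnSeries.order_eq_orderTop_of_ne_zero hx']
        exact_mod_cast (by linarith : (0 : ℚ) ≤ x⁻¹.order)

variable {k}

/-- Constants lie in the valuation ring. [folklore] -/
theorem algebraMap_mem_of_hahn (O : ValuationSubring (HahnSeries ℚ k))
    (hO : ∀ x, x ∈ O ↔ 0 ≤ x.orderTop) (c : k) :
    algebraMap k (HahnSeries ℚ k) c ∈ O := by
  -- Mathlib's preferred instance `HahnSeries.powerSeriesAlgebra` factors `algebraMap` through `k⟦X⟧`
  rw [hO, HahnSeries.algebraMap_apply', ← PowerSeries.C_eq_algebraMap, HahnSeries.ofPowerSeries_C,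
    HahnSeries.C_apply, ← WithTop.coe_zero]
  exact HahnSeries.orderTop_single_le

/-- The valuation ring `{orderTop ≥ 0}` has DIMENSION ZERO over `k`: the residue of `y` is the
constant `y₀ = y.coeff 0 ∈ k`, killed by `X - y₀`. [folklore] -/
theorem hahn_dimZero (O : ValuationSubring (HahnSeries ℚ k)) (hO : ∀ x, x ∈ O ↔ 0 ≤ x.orderTop)
    (y : HahnSeries ℚ k) (hy : y ∈ O) :
    ∃ f : Polynomial k, f ≠ 0 ∧ O.valuation (Polynomial.aeval y f) < 1 := by
  refine ⟨Polynomial.X - Polynomial.C (y.coeff 0), Polynomial.X_sub_C_ne_zero _, ?_⟩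
  have haeval : Polynomial.aeval y (Polynomial.X - Polynomial.C (y.coeff 0)) =
      y - HahnSeries.C (y.coeff 0) := by
    rw [map_sub, Polynomial.aeval_X, Polynomial.aeval_C, HahnSeries.algebraMap_apply',
      ← PowerSeries.C_eq_algebraMap, HahnSeries.ofPowerSeries_C]
  rw [haeval]
  have hC : HahnSeries.C (y.coeff 0) ∈ O := by
    have := algebraMap_mem_of_hahn O hO (y.coeff 0)
    rwa [HahnSeries.algebraMap_apply', ← PowerSeries.C_eq_algebraMap, HahnSeries.ofPowerSeries_C] at this
  have hzO : y - HahnSeries.C (y.coeff 0) ∈ O := sub_mem hy hC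
  rw [← ValuationSubring.mem_nonunits_iff, ValuationSubring.mem_nonunits_iff_or]
  by_cases hz0 : y - HahnSeries.C (y.coeff 0) = 0
  · exact Or.inl hz0
  · right
    intro hzinv
    have h1 : (0 : WithTop ℚ) ≤ (y - HahnSeries.C (y.coeff 0))⁻¹.orderTop := (hO _).1 hzinv
    have h2 : (0 : WithTop ℚ) ≤ (y - HahnSeries.C (y.coeff 0)).orderTop := (hO _).1 hzO
    have hcoeff : (y - HahnSeries.C (y.coeff 0)).coeff 0 = 0 := by
      rw [HahnSeries.coeff_sub, HahnSeries.C_apply, HahnSeries.coeff_single_same, sub_self]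
    have hord0 : (0 : ℚ) ≤ (y - HahnSeries.C (y.coeff 0)).order := by
      rw [← HahnSeries.order_eq_orderTop_of_ne_zero hz0] at h2
      exact_mod_cast h2
    have hzord : (0 : ℚ) < (y - HahnSeries.C (y.coeff 0)).order := by
      rcases lt_or_eq_of_le hord0 with h | h
      · exact h
      · have h' : (y - HahnSeries.C (y.coeff 0)).coeff (y - HahnSeries.C (y.coeff 0)).order = 0 := by
          rw [← h]; exact hcoeff
        exact absurd (HahnSeries.coeff_order_eq_zero.1 h') hz0
    have hsum : (y - HahnSeries.C (y.coeff 0)).order + (y - HahnSeries.C (y.coeff 0))⁻¹.order = 0 := by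
      rw [← HahnSeries.order_mul hz0 (inv_ne_zero hz0), mul_inv_cancel₀ hz0, HahnSeries.order_one]
    have hinv : (0 : ℚ) ≤ (y - HahnSeries.C (y.coeff 0))⁻¹.order := by
      rw [← HahnSeries.order_eq_orderTop_of_ne_zero (inv_ne_zero hz0)] at h1
      exact_mod_cast h1
    linarith

/-- A ring with the same elements as `{orderTop ≥ 0} ⊆ k((t^ℚ))` is NOT Noetherian: the principal
ideals `(t^{1/(n+1)})` strictly increase. [folklore] -/
theorem not_isNoetherianRing_of_hahn {k₀ : Type} [Field k₀] [Algebra k₀ (HahnSeries ℚ k)]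
    (O : ValuationSubring (HahnSeries ℚ k)) (hO : ∀ x, x ∈ O ↔ 0 ≤ x.orderTop)
    (A : Subalgebra k₀ (HahnSeries ℚ k)) (hAO : ∀ x, x ∈ A ↔ x ∈ O) :
    ¬ IsNoetherianRing ↥A := by
  intro hN
  have hmem : ∀ q : ℚ, 0 ≤ q → HahnSeries.single q (1 : k) ∈ A := fun q hq =>
    (hAO _).2 ((hO _).2 (by rw [HahnSeries.orderTop_single one_ne_zero]; exact_mod_cast hq))
  have hpos : ∀ n : ℕ, (0 : ℚ) < 1 / ((n : ℚ) + 1) := fun n => by positivity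
  let t : ℕ → ↥A := fun n => ⟨HahnSeries.single (1 / ((n : ℚ) + 1)) (1 : k), hmem _ (hpos n).le⟩
  have hanti : ∀ n : ℕ, (1 : ℚ) / ((↑(n + 1) : ℚ) + 1) ≤ 1 / ((n : ℚ) + 1) := fun n =>
    one_div_le_one_div_of_le (by positivity) (by push_cast; linarith)
  have hdvd : ∀ n : ℕ, t (n + 1) ∣ t n := fun n => by
    refine Dvd.intro ⟨HahnSeries.single (1 / ((n : ℚ) + 1) - 1 / ((↑(n + 1) : ℚ) + 1)) (1 : k),
      hmem _ (sub_nonneg.2 (hanti n))⟩ (Subtype.ext ?_)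
    show HahnSeries.single _ _ * HahnSeries.single _ _ = HahnSeries.single _ _
    rw [HahnSeries.single_mul_single, mul_one, add_sub_cancel]
  let f : ℕ →o Ideal ↥A :=
    ⟨fun n => Ideal.span {t n}, monotone_nat_of_le_succ fun n =>
      (Ideal.span_singleton_le_span_singleton).2 (hdvd n)⟩
  obtain ⟨N, hN'⟩ := (monotone_stabilizes_iff_noetherian.mpr hN) f
  have hEq : Ideal.span {t N} = Ideal.span {t (N + 1)} := hN' (N + 1) (Nat.le_succ N)
  have hIn : t (N + 1) ∈ Ideal.span {t N} := hEq ▸ Ideal.subset_span (Set.mem_singleton _)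
  obtain ⟨a, ha⟩ := Ideal.mem_span_singleton'.1 hIn
  have haK : ((a : HahnSeries ℚ k) * HahnSeries.single (1 / ((N : ℚ) + 1)) (1 : k)) =
      HahnSeries.single (1 / ((↑(N + 1) : ℚ) + 1)) (1 : k) := congrArg Subtype.val ha
  have ha0 : (0 : WithTop ℚ) ≤ (a : HahnSeries ℚ k).orderTop := (hO _).1 ((hAO _).1 a.2)
  have key : (((1 : ℚ) / ((N : ℚ) + 1) : ℚ) : WithTop ℚ) ≤ (((1 : ℚ) / ((↑(N + 1) : ℚ) + 1) : ℚ) : WithTop ℚ) :=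
    calc (((1 : ℚ) / ((N : ℚ) + 1) : ℚ) : WithTop ℚ)
        = 0 + (HahnSeries.single (1 / ((N : ℚ) + 1)) (1 : k)).orderTop := by
          rw [HahnSeries.orderTop_single one_ne_zero, zero_add]
      _ ≤ (a : HahnSeries ℚ k).orderTop + (HahnSeries.single (1 / ((N : ℚ) + 1)) (1 : k)).orderTop :=
          add_le_add ha0 le_rfl
      _ ≤ ((a : HahnSeries ℚ k) * HahnSeries.single (1 / ((N : ℚ) + 1)) (1 : k)).orderTop :=
          HahnSeries.orderTop_add_le_mul
      _ = (HahnSeries.single (1 / ((↑(N + 1) : ℚ) + 1)) (1 : k)).orderTop := by rw [haK]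
      _ = _ := HahnSeries.orderTop_single one_ne_zero
  have key' : (1 : ℚ) / ((N : ℚ) + 1) ≤ 1 / ((↑(N + 1) : ℚ) + 1) := WithTop.coe_le_coe.mp key
  have hlt : (1 : ℚ) / ((↑(N + 1) : ℚ) + 1) < 1 / ((N : ℚ) + 1) :=
    one_div_lt_one_div_of_lt (by positivity) (by push_cast; linarith)
  linarith

end Hahn

/-- A valuation ring of `K ⊇ k` containing `k` is (the underlying ring of) a `k`-subalgebra.
[folklore] -/
theorem exists_subalgebra_of_valuationSubring {k K : Type} [Field k] [Field K] [Algebra k K]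
    (O : ValuationSubring K) (hk : ∀ c : k, algebraMap k K c ∈ O) :
    ∃ A : Subalgebra k K, ∀ x, x ∈ A ↔ x ∈ O :=
  ⟨{ O.toSubring with algebraMap_mem' := fun c => hk c }, fun _ => Iff.rfl⟩

/-! ## `A.FG` is load-bearing: without it the antecedent is false in every prime characteristic -/

/-- **The `FG`-free antecedent of `SyzygyFlattening.Globalisation` is FALSE** (every prime `p`): the
crux's antecedent (the route file's `let`-telescope, verbatim) with the single binder `A.FG →` deleted
fails at `k = 𝔽_p`, `K = HahnSeries ℚ 𝔽_p`, `O = {orderTop ≥ 0}`, `A = O`. [folklore] -/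
theorem syzygyTower_termination_false_without_FG (p : ℕ) (hp : p.Prime) :
    ¬ (∀ (k K : Type) [Field k] [CharP k p] [Field K] [Algebra k K] (O : ValuationSubring K) (A : Subalgebra k K), (∀ c : k, algebraMap k K c ∈ O) → IsFractionRing ↥A K → A.toSubring ≤ O.toSubring → (∀ y : K, y ∈ O → ∃ f : Polynomial k, f ≠ 0 ∧ O.valuation (Polynomial.aeval y f) < 1) → let n : ℕ := Cardinal.toNat (Algebra.trdeg k K); let J : (B : Subalgebra k K) → Ideal ↥B := fun B => sInf ((fun 𝔭 : PrimeSpectrum ↥B => 𝔭.asIdeal) '' {𝔭 : PrimeSpectrum ↥B | ¬ IsRegularLocalRing (Localization.AtPrime 𝔭.asIdeal)}); let loc : Subalgebra k K → Subalgebra k K := fun B => Algebra.adjoin k {y : K | ∃ a ∈ B, ∃ s ∈ B, s⁻¹ ∈ O ∧ y = a * s⁻¹}; let chart : Subalgebra k K → Subalgebra k K := fun B => Algebra.adjoin k ((B : Set K) ∪ {y : K | ∃ (b : ℕ → ℕ) (d : (i : ℕ) → ((Fin (b (i + 1)) → ↥B) →ₗ[↥B] (Fin (b i) → ↥B))) (ε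 : (Fin (b 0) → ↥B) →ₗ[↥B] (↥B ⧸ J B)) (r : ℕ) (ι : ↥(LinearMap.range (d (n - 1))) →ₗ[↥B] (Fin r → ↥B)), Function.Surjective ε ∧ Function.Exact (d 0) ε ∧ (∀ i : ℕ, Function.Exact (d (i + 1)) (d i)) ∧ Function.Injective ι ∧ (∀ z : Fin r → ↥B, ∃ a : ↥B, a ≠ 0 ∧ a • z ∈ LinearMap.range ι) ∧ ∃ g x : Fin r → ↥(LinearMap.range (d (n - 1))), Matrix.det (Matrix.of fun i j => ((ι (x i) j : ↥B) : K)) ≠ 0 ∧ (∀ g' : Fin r → ↥(LinearMap.range (d (n - 1))), Matrix.det (Matrix.of fun i j => ((ι (g' i) j : ↥B) : K)) * (Matrix.det (Matrix.of fun i j => ((ι (x i) j : ↥B) : K)))⁻¹ ∈ O) ∧ y = Matrix.det (Matrix.of fun i j => ((ι (g i) j : ↥B) : K)) * (Matrix.det (Matrix.of fun i j => ((ι (x i) j : ↥B) : K)))⁻¹}); let nrm : Subalgebra k K → Subalgebra k K := fun B => Algebra.adjoin k {y : K | IsIntegral ↥B y}; let tower : Subalgebra k K → ℕ → Subalgebra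 k K := fun A m => @Nat.rec (fun _ => Subalgebra k K) (loc A) (fun _ B => loc (nrm (chart B))) m; ∃ m : ℕ, IsRegularLocalRing ↥(tower A m)) := by
  intro H
  haveI : Fact p.Prime := ⟨hp⟩
  obtain ⟨O, hO⟩ := exists_valuationSubring_hahnSeries (ZMod p)
  have hk : ∀ c : ZMod p, algebraMap (ZMod p) (HahnSeries ℚ (ZMod p)) c ∈ O :=
    algebraMap_mem_of_hahn O hO
  obtain ⟨A, hAO⟩ := exists_subalgebra_of_valuationSubring O hk
  haveI : IsFractionRing ↥A (HahnSeries ℚ (ZMod p)) :=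
    (integers_of_forall_mem_iff O A hAO).isFractionRing
  have H' := H (ZMod p) (HahnSeries ℚ (ZMod p)) O A hk inferInstance
    (fun x hx => (hAO x).1 hx) (hahn_dimZero O hO)
  dsimp only at H'
  obtain ⟨m, hm⟩ := H'
  have key : ∀ X : Subalgebra (ZMod p) (HahnSeries ℚ (ZMod p)), X = A → IsRegularLocalRing ↥X → False := by
    rintro X rfl h
    exact not_isNoetherianRing_of_hahn O hO X hAO h.toIsNoetherian
  refine key _ (natRec_const m ?_ ?_) hm
  · exact syzLoc_fix O A hAO
  · intro m'
    rw [syzChart_fix O A hAO, syzNrm_fix O A hAO, syzLoc_fix O A hAO]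

end Summit.ResolutionOfSingularities.ResolutionOfSingularities.Theorems.Globalisation.Negative

end
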